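import Literature.MathematicalPhysics.QuantumLattice.TorusBandParticleHole
import Summits.HubbardSuperconductivity.HubbardSuperconductivity.Theorems.SoloBlindNagaokaWitness
import Summits.HubbardSuperconductivity.HubbardSuperconductivity.Theorems.SoloBlindDiamondFermiSea
import HarnessLib

/-!
# The Nagaoka ceiling: the summit's sector floor is capped by `-4δL² + O(δ²L²)`, uniformly in `U`

Solo-blind residency `solo-HubbardSuperconductivity-blind`, generation 30, Theorem 35 (part 2 of 2;
part 1 is `SoloBlindNagaokaWitness`).

Part 1 exhibited, for every duplicate-free list of `2n` momenta, a vector of the summit's sector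
`szSector (2n) 0` with ZERO singlet pair order on which `H_U + c·Δ_gᴴΔ_g` acts as the free
polarised energy, for every real `U`, `c` and every form factor `g`. Here the momenta are chosen:
all of the Brillouin zone except a HOLE POCKET at the zone corner `Q = (π, π)` — the half-zone
shift of the lattice diamond `|j₁| + |j₂| ≤ K` of Theorem 15 (`SoloBlindDiamondFermiSea`), padded by
arbitrary further holes. Particle–hole symmetry `ε(k + Q) = -ε(k)` (`torusBand_add_halfShift`) and
the Dirichlet-kernel evaluation of the diamond (`diamondSum_ge`) give

* `minEnergyOn_crutch_le_sum` — Theorem 35 for a momentum SET `A`, `|A| = 2n`;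
* `minEnergyOn_crutch_le_nagaokaCeiling` — **Theorem 35′**: for even `L ≥ 4`, `2K + 1 ≤ L`,
  `2K² + 2K + 1 ≤ L² - 2n`, every real `U`, `c` and every `g`,
  `minEnergyOn (H_U + c·Δ_gᴴΔ_g) (szSector (2n) 0) ≤ -(8L²/π²)sin²(Kπ/L) + 4(L² - 2n - (2K²+2K+1))`.

With `2n = (1-δ)L²` and `2K² ≈ δL²` the right side is `-4δL² + (2π²/3)δ²L² + o(L²)`: the Mott
floor `-4δL² - 64L²/U` of Theorem 34 is attained to `O(δ² + 1/U)` by a state WITHOUT pair order, at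
every `U`, and adding a pair crutch of any sign and strength does not lower this cap. Consequence
recorded in the obstruction report (§5.20(10)): a floor-versus-condensate certification of d-wave
order (Theorems 33′/34) can never reach crutch strengths below
`g₁(δ) = (16/π²) sin²(π√(δ/2)) / (δ(1-δ)) + o(1) ∈ (6.4, 8)`, whatever floor is used, because below
`g₁` the dimer condensate lies above a zero-order eigenvalue.

Elementary; no sorry. [this work] for the assembly, [folklore] for the band bookkeeping.
-/

noncomputable section

namespace Summit.HubbardSuperconductivity.HubbardSuperconductivity.Theorems.NagaokaWitness

open Matrix Finset Real Literature.MathematicalPhysics.QuantumLattice HubbardWave0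
  Literature.Probability.LatticeModels
open Summit.HubbardSuperconductivity.HubbardSuperconductivity.Theorems.WeakCouplingSpin

variable {L : ℕ} [NeZero L]

/-- **Theorem 35, set form.** For `L ≥ 3`, every real `U`, `c`, every form factor `g` and every
momentum set `A` with `|A| = 2n`:
`minEnergyOn (H_U + c·Δ_gᴴΔ_g) (szSector (2n) 0) ≤ Σ_{k∈A} ε_L(k)`.
[this work] -/
theorem minEnergyOn_crutch_le_sum (hL : 3 ≤ L) (U c : ℝ) (g : Site 2 → ℝ)
    (A : Finset (TorusSite 2 L)) (n : ℕ) (hA : A.card = 2 * n) :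
    (hubbardTorus 2 L 1 U + (c : ℂ) • ((pairField g L)ᴴ * pairField g L)).minEnergyOn
        (szSector (Λ := FermionTorus 2 L) (2 * n) 0) ≤ ∑ k ∈ A, torusBand L k := by
  have h := minEnergyOn_crutch_le_polarizedSum hL U c g A.nodup_toList n
    (by rw [Finset.length_toList, hA])
  rwa [Finset.toList_toFinset] at h

/-- **Particle–hole reflection of a momentum set**: `Σ_{k ∈ D + Q} ε = -Σ_{k ∈ D} ε` for even `L`
and the half-zone shift `Q = (L/2, L/2)` (i.e. `(π, π)`). [folklore] -/
theorem sum_map_halfShift_torusBand (hL : Even L) (D : Finset (TorusSite 2 L)) :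
    ∑ k ∈ D.map (addRightEmbedding (fun _ => ((L / 2 : ℕ) : ZMod L) : TorusSite 2 L)),
      torusBand L k = -∑ k ∈ D, torusBand L k := by
  rw [Finset.sum_map, ← Finset.sum_neg_distrib]
  refine Finset.sum_congr rfl fun k _ => ?_
  rw [addRightEmbedding_apply]
  exact torusBand_add_halfShift hL k

/-- **A hole pocket at the zone corner.** For even `L`, `2K + 1 ≤ L` and `2K² + 2K + 1 ≤ h ≤ L²`
there is a momentum set `B` ("holes") with `|B| = h` and
`Σ_{k ∈ B} ε ≥ (8L²/π²) sin²(Kπ/L) - 4 (h - (2K² + 2K + 1))`: the shifted diamond plus `h - |◇|`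
arbitrary further levels (each `≥ -4`). [folklore] -/
theorem exists_holePocket (hLe : Even L) (hL : 2 ≤ L) {K h : ℕ} (hK : 2 * K + 1 ≤ L)
    (hKh : 2 * K ^ 2 + 2 * K + 1 ≤ h) (hh : h ≤ L ^ 2) :
    ∃ B : Finset (TorusSite 2 L), B.card = h ∧
      8 * (L : ℝ) ^ 2 * Real.sin ((K : ℝ) * π / L) ^ 2 / π ^ 2 -
          4 * ((h : ℝ) - (2 * (K : ℝ) ^ 2 + 2 * K + 1)) ≤ ∑ k ∈ B, torusBand L k := by
  classical
  set DQ := (diamondSet L K).map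
    (addRightEmbedding (fun _ => ((L / 2 : ℕ) : ZMod L) : TorusSite 2 L)) with hDQ
  have hDcardR : ((diamondSet L K).card : ℝ) = 2 * (K : ℝ) ^ 2 + 2 * K + 1 := card_diamondSet hK
  have hDcard : (diamondSet L K).card = 2 * K ^ 2 + 2 * K + 1 := by exact_mod_cast hDcardR
  have hDQcard : DQ.card = 2 * K ^ 2 + 2 * K + 1 := by rw [hDQ, Finset.card_map, hDcard]
  -- room for the padding
  have hroom : h - (2 * K ^ 2 + 2 * K + 1) ≤ DQᶜ.card := by
    rw [Finset.card_compl, card_torusSite_two, hDQcard]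
    omega
  obtain ⟨E, hEsub, hEcard⟩ := Finset.exists_subset_card_eq hroom
  have hdisj : Disjoint DQ E := by
    rw [Finset.disjoint_iff_ne]
    rintro a ha b hb rfl
    exact (Finset.mem_compl.1 (hEsub hb)) ha
  refine ⟨DQ ∪ E, ?_, ?_⟩
  · rw [Finset.card_union_of_disjoint hdisj, hDQcard, hEcard]
    omega
  · rw [Finset.sum_union hdisj, hDQ, sum_map_halfShift_torusBand hLe, sum_diamondSet_torusBand hK]
    have hdia := diamondSum_ge hL hK
    have hE := neg_four_mul_card_le_fermiSum E
    rw [hEcard, Nat.cast_sub hKh] at hE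
    push_cast at hE
    have hlink : 8 * (L : ℝ) ^ 2 * Real.sin ((K : ℝ) * π / L) ^ 2 / π ^ 2 =
        2 * (4 * (L : ℝ) ^ 2 * Real.sin ((K : ℝ) * π / L) ^ 2 / π ^ 2) := by ring
    linarith [hdia, hE, hlink]

/-- **Theorem 35′ (the Nagaoka ceiling on the summit's sector floor, uniform in `U` and in the
crutch).** For even `L ≥ 4`, `2K + 1 ≤ L`, `2n ≤ L²` with `2K² + 2K + 1 ≤ L² - 2n` holes, every real
`U`, `c` and every form factor `g`:
`minEnergyOn (H_U + c·Δ_gᴴΔ_g) (szSector (2n) 0) ≤ -(8L²/π²) sin²(Kπ/L) + 4 (L² - 2n - (2K²+2K+1))`.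
With `2n = (1-δ)L²`, `K ≈ L√(δ/2)`: `≤ -4δL² + (2π²/3)δ²L² + o(L²)`, attained in Rayleigh quotient
by a vector with zero pair order. [this work] -/
theorem minEnergyOn_crutch_le_nagaokaCeiling (hLe : Even L) (hL : 4 ≤ L) (U c : ℝ)
    (g : Site 2 → ℝ) {K n : ℕ} (hK : 2 * K + 1 ≤ L) (hn : 2 * n ≤ L ^ 2)
    (hKn : 2 * K ^ 2 + 2 * K + 1 ≤ L ^ 2 - 2 * n) :
    (hubbardTorus 2 L 1 U + (c : ℂ) • ((pairField g L)ᴴ * pairField g L)).minEnergyOn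
        (szSector (Λ := FermionTorus 2 L) (2 * n) 0) ≤
      -(8 * (L : ℝ) ^ 2 * Real.sin ((K : ℝ) * π / L) ^ 2 / π ^ 2) +
        4 * ((L : ℝ) ^ 2 - 2 * n - (2 * (K : ℝ) ^ 2 + 2 * K + 1)) := by
  classical
  obtain ⟨B, hBcard, hBsum⟩ :=
    exists_holePocket hLe (by omega) hK hKn (Nat.sub_le _ _)
  have hAcard : Bᶜ.card = 2 * n := by
    rw [Finset.card_compl, card_torusSite_two, hBcard]
    omega
  have h := minEnergyOn_crutch_le_sum (by omega) U c g Bᶜ n hAcard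
  rw [sum_compl_torusBand_eq_neg (by omega) B] at h
  have hcast : ((L ^ 2 - 2 * n : ℕ) : ℝ) = (L : ℝ) ^ 2 - 2 * n := by
    rw [Nat.cast_sub hn]
    push_cast
    ring
  rw [hcast] at hBsum
  linarith

/-- **Corollary (the bare Hubbard floor).** Same bound for `minEnergyOn H_U (szSector (2n) 0)`,
every real `U`. [this work] -/
theorem minEnergyOn_le_nagaokaCeiling (hLe : Even L) (hL : 4 ≤ L) (U : ℝ) {K n : ℕ}
    (hK : 2 * K + 1 ≤ L) (hn : 2 * n ≤ L ^ 2) (hKn : 2 * K ^ 2 + 2 * K + 1 ≤ L ^ 2 - 2 * n) :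
    (hubbardTorus 2 L 1 U).minEnergyOn (szSector (Λ := FermionTorus 2 L) (2 * n) 0) ≤
      -(8 * (L : ℝ) ^ 2 * Real.sin ((K : ℝ) * π / L) ^ 2 / π ^ 2) +
        4 * ((L : ℝ) ^ 2 - 2 * n - (2 * (K : ℝ) ^ 2 + 2 * K + 1)) := by
  have h := minEnergyOn_crutch_le_nagaokaCeiling hLe hL U 0 dWaveFormFactor hK hn hKn
  rwa [Complex.ofReal_zero, zero_smul, add_zero] at h

end Summit.HubbardSuperconductivity.HubbardSuperconductivity.Theorems.NagaokaWitness
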